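import Summits.Langlands.Langlands.Theorems.PicardMuOrdinaryMuOrdinaryFamilyRTPointPlan
import Mathlib.LinearAlgebra.CrossProduct

/-!
# The Picard point of line `free-seed-smooth-rt` (crux `MuOrdinaryFamilyRT`, stmt-Langlands-13757):
# `3 × 3` linear algebra for LEAF `modelBorel`

Helper file for the registered stub `stub_point` (plan: `…PointPlan.lean`).  Elementary facts, all PROVED:

* `sq_dvd_charpoly_of_eigenvectors` — two independent eigenvectors (`v × w ≠ 0`) of `M ∈ M₃(F)` for the
  eigenvalue `c` force `(X - c)² ∣ charpoly M` (change of basis to `(v, w, e_k)`, block-triangular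
  characteristic polynomial);
* `IsUpper3.mul_apply_diag/mul/det/inv` — the tree's upper-triangular predicate `IsUpper3` is stable under
  products and inverses, with multiplicative diagonal;
* `exists_eq_diag_of_common_eigenvector` (and the row version) — a common (row) eigenvector of
  upper-triangular matrices has as character the diagonal character at the top (bottom) of its support;
* **`diag_pairwise_ne_of_conj`** — if `T₀(τ) M = M T₁(τ)` with `M` invertible and `T₀, T₁` invertible
  upper triangular, the diagonal characters of `T₁` are a permutation of those of `T₀` (first column of
  `M`, last row of `M⁻¹`, `(M⁻¹M)₂₀ = 0`, determinants), so pairwise distinctness transfers;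
* `exists_separating` — three pairwise distinct sign characters are separated as `χa(h) ≠ χb(h) = χc(h)`.
-/

-- `Summit.Langlands.Langlands.…` (summit = sub-problem name, D-0017 layout) trips `dupNamespace` on every decl.
set_option linter.dupNamespace false

namespace Summit.Langlands.Langlands.Cruxes.MuOrdinaryFamilyRT.FreeSeedSmoothRt

open scoped Matrix Polynomial
open Polynomial

noncomputable section

/-! ### Two independent eigenvectors force a double root of the characteristic polynomial -/

section Eigen

variable {F : Type*} [Field F]

/-- If `v, w` are linearly independent eigenvectors of `M ∈ M₃(F)` for the same eigenvalue `c`, then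
`(X - c)² ∣ charpoly M`. -/
theorem sq_dvd_charpoly_of_eigenvectors (M : Matrix (Fin 3) (Fin 3) F) (c : F) (v w : Fin 3 → F)
    (hv : M *ᵥ v = c • v) (hw : M *ᵥ w = c • w) (hind : crossProduct v w ≠ 0) :
    (X - C c) ^ 2 ∣ M.charpoly := by
  obtain ⟨k, hk⟩ : ∃ k, crossProduct v w k ≠ 0 := by
    by_contra h
    push Not at h
    exact hind (funext h)
  -- the base-change matrix with columns `v, w, e_k`
  set P : Matrix (Fin 3) (Fin 3) F := (Matrix.of ![v, w, Pi.single k 1])ᵀ with hP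
  have hdet : P.det ≠ 0 := by
    rw [hP, Matrix.det_transpose]
    change Matrix.det ![v, w, Pi.single k 1] ≠ 0
    rw [← triple_product_eq_det, triple_product_permutation, triple_product_permutation, dotProduct_comm,
      dotProduct_single_one]
    · exact hk
  have hPu : IsUnit P := (Matrix.isUnit_iff_isUnit_det P).mpr (isUnit_iff_ne_zero.mpr hdet)
  obtain ⟨u, hu⟩ := hPu
  have hP0 : P *ᵥ Pi.single 0 1 = v := by
    rw [Matrix.mulVec_single_one]; ext i; simp [hP]
  have hP1 : P *ᵥ Pi.single 1 1 = w := by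
    rw [Matrix.mulVec_single_one]; ext i; simp [hP]
  set N : Matrix (Fin 3) (Fin 3) F := P⁻¹ * M * P with hN
  have hinv : P⁻¹ * P = 1 := Matrix.nonsing_inv_mul P (isUnit_iff_ne_zero.mpr hdet)
  have hN0 : N *ᵥ Pi.single 0 1 = c • Pi.single 0 1 := by
    rw [hN, ← Matrix.mulVec_mulVec, ← Matrix.mulVec_mulVec, hP0, hv, Matrix.mulVec_smul, ← hP0, Matrix.mulVec_mulVec,
      hinv, Matrix.one_mulVec]
  have hN1 : N *ᵥ Pi.single 1 1 = c • Pi.single 1 1 := by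
    rw [hN, ← Matrix.mulVec_mulVec, ← Matrix.mulVec_mulVec, hP1, hw, Matrix.mulVec_smul, ← hP1, Matrix.mulVec_mulVec,
      hinv, Matrix.one_mulVec]
  have hcol0 : ∀ i, N i 0 = c * (Pi.single (0 : Fin 3) (1 : F) : Fin 3 → F) i := fun i => by
    have := congrFun hN0 i
    rwa [Matrix.mulVec_single_one, Pi.smul_apply, smul_eq_mul] at this
  have hcol1 : ∀ i, N i 1 = c * (Pi.single (1 : Fin 3) (1 : F) : Fin 3 → F) i := fun i => by
    have := congrFun hN1 i
    rwa [Matrix.mulVec_single_one, Pi.smul_apply, smul_eq_mul] at this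
  have hNtri : N.BlockTriangular id := by
    intro i j hij
    fin_cases i <;> fin_cases j <;> simp at hij <;> simp [hcol0, hcol1]
  have hcp : N.charpoly = (X - C c) * (X - C c) * (X - C (N 2 2)) := by
    rw [Matrix.charpoly_of_upperTriangular N hNtri, Fin.prod_univ_three, hcol0, hcol1]
    simp
  have hMN : M.charpoly = N.charpoly := by rw [hN, ← hu, (Matrix.charpoly_units_conj' u M).symm]
  rw [hMN, hcp, pow_two]
  exact dvd_mul_right _ _

end Eigen

/-! ### Upper-triangular `3 × 3` matrices: diagonal characters -/

section Upper

variable {k : Type*} [Field k]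

/-- The diagonal of a product of upper-triangular `3 × 3` matrices. -/
theorem IsUpper3.mul_apply_diag {A B : Matrix (Fin 3) (Fin 3) k} (hA : IsUpper3 A) (hB : IsUpper3 B) (i : Fin 3) :
    (A * B) i i = A i i * B i i := by
  obtain ⟨hA10, hA20, hA21⟩ := hA
  obtain ⟨hB10, hB20, hB21⟩ := hB
  fin_cases i <;> simp [Matrix.mul_apply, Fin.sum_univ_three, hA10, hA20, hA21, hB10, hB20, hB21]

/-- The product of upper-triangular `3 × 3` matrices is upper triangular. -/
theorem IsUpper3.mul {A B : Matrix (Fin 3) (Fin 3) k} (hA : IsUpper3 A) (hB : IsUpper3 B) : IsUpper3 (A * B) := by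
  obtain ⟨hA10, hA20, hA21⟩ := hA
  obtain ⟨hB10, hB20, hB21⟩ := hB
  refine ⟨?_, ?_, ?_⟩ <;> simp [Matrix.mul_apply, Fin.sum_univ_three, hA10, hA20, hA21, hB10, hB20, hB21]

/-- The determinant of an upper-triangular `3 × 3` matrix. -/
theorem IsUpper3.det {A : Matrix (Fin 3) (Fin 3) k} (hA : IsUpper3 A) : A.det = A 0 0 * A 1 1 * A 2 2 := by
  obtain ⟨hA10, hA20, hA21⟩ := hA
  rw [Matrix.det_fin_three]
  simp [hA10, hA20, hA21]

/-- The inverse of an invertible upper-triangular `3 × 3` matrix is upper triangular. -/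
theorem IsUpper3.inv {A : Matrix (Fin 3) (Fin 3) k} (hA : IsUpper3 A) (hdet : A.det ≠ 0) : IsUpper3 A⁻¹ := by
  obtain ⟨hA10, hA20, hA21⟩ := hA
  have h00 : A 0 0 ≠ 0 := by
    intro h; apply hdet; rw [IsUpper3.det ⟨hA10, hA20, hA21⟩, h]; ring
  have h11 : A 1 1 ≠ 0 := by
    intro h; apply hdet; rw [IsUpper3.det ⟨hA10, hA20, hA21⟩, h]; ring
  have hmul : A⁻¹ * A = 1 := Matrix.nonsing_inv_mul A (isUnit_iff_ne_zero.mpr hdet)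
  have e10 : (A⁻¹ * A) 1 0 = (1 : Matrix (Fin 3) (Fin 3) k) 1 0 := by rw [hmul]
  have e20 : (A⁻¹ * A) 2 0 = (1 : Matrix (Fin 3) (Fin 3) k) 2 0 := by rw [hmul]
  have e21 : (A⁻¹ * A) 2 1 = (1 : Matrix (Fin 3) (Fin 3) k) 2 1 := by rw [hmul]
  simp only [Matrix.mul_apply, Fin.sum_univ_three, hA10, hA20, hA21, mul_zero, add_zero] at e10 e20 e21
  simp only [Matrix.one_apply] at e10 e20 e21
  simp at e10 e20 e21
  have h10 : A⁻¹ 1 0 = 0 := e10.resolve_right h00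
  have h20 : A⁻¹ 2 0 = 0 := e20.resolve_right h00
  rw [h20, zero_mul, zero_add] at e21
  exact ⟨h10, h20, (mul_eq_zero.mp e21).resolve_right h11⟩

/-- **A common eigenvector of upper-triangular matrices has a diagonal character.**  If `u ≠ 0` and
`T(τ) u = ψ(τ) u` for all `τ`, with all `T(τ)` upper triangular, then `ψ = (τ ↦ T(τ)_{mm})` for the
largest index `m` in the support of `u`. -/
theorem exists_eq_diag_of_common_eigenvector {H : Type*} (T : H → Matrix (Fin 3) (Fin 3) k) (hT : ∀ τ, IsUpper3 (T τ))
    (u : Fin 3 → k) (hu : u ≠ 0) (ψ : H → k) (h : ∀ τ, T τ *ᵥ u = ψ τ • u) :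
    ∃ m : Fin 3, u m ≠ 0 ∧ (∀ l, m < l → u l = 0) ∧ ∀ τ, ψ τ = T τ m m := by
  -- the largest index in the support
  obtain ⟨m, hm, hmax⟩ : ∃ m : Fin 3, u m ≠ 0 ∧ ∀ l, m < l → u l = 0 := by
    by_cases h2 : u 2 = 0
    · by_cases h1 : u 1 = 0
      · have h0 : u 0 ≠ 0 := by
          intro h0; apply hu; ext i; fin_cases i <;> assumption
        exact ⟨0, h0, fun l hl => by fin_cases l <;> simp_all⟩
      · exact ⟨1, h1, fun l hl => by fin_cases l <;> simp_all⟩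
    · exact ⟨2, h2, fun l hl => by fin_cases l <;> simp_all⟩
  refine ⟨m, hm, hmax, fun τ => ?_⟩
  obtain ⟨h10, h20, h21⟩ := hT τ
  have e := congrFun (h τ) m
  simp only [Matrix.mulVec, dotProduct, Fin.sum_univ_three, Pi.smul_apply, smul_eq_mul] at e
  fin_cases m
  · simp only [Fin.zero_eta] at e hmax ⊢
    rw [hmax 1 (by decide), hmax 2 (by decide)] at e
    simp only [mul_zero, add_zero] at e
    exact (mul_left_inj' hm).mp e.symm
  · simp only [Fin.mk_one] at e hmax ⊢
    rw [hmax 2 (by decide), h10] at e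
    simp only [mul_zero, add_zero, zero_mul, zero_add] at e
    exact (mul_left_inj' hm).mp e.symm
  · simp only [Fin.reduceFinMk] at e ⊢
    rw [h20, h21] at e
    simp only [zero_mul, zero_add] at e
    exact (mul_left_inj' hm).mp e.symm

/-- Row version: a common row eigenvector `y ≠ 0`, `y T(τ) = ψ(τ) y`, has `ψ = (τ ↦ T(τ)_{mm})` for the
smallest index `m` in the support of `y`. -/
theorem exists_eq_diag_of_common_row_eigenvector {H : Type*} (T : H → Matrix (Fin 3) (Fin 3) k)
    (hT : ∀ τ, IsUpper3 (T τ)) (y : Fin 3 → k) (hy : y ≠ 0) (ψ : H → k) (h : ∀ τ, Matrix.vecMul y (T τ) = ψ τ • y) :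
    ∃ m : Fin 3, y m ≠ 0 ∧ (∀ l, l < m → y l = 0) ∧ ∀ τ, ψ τ = T τ m m := by
  obtain ⟨m, hm, hmin⟩ : ∃ m : Fin 3, y m ≠ 0 ∧ ∀ l, l < m → y l = 0 := by
    by_cases h0 : y 0 = 0
    · by_cases h1 : y 1 = 0
      · have h2 : y 2 ≠ 0 := by
          intro h2; apply hy; ext i; fin_cases i <;> assumption
        exact ⟨2, h2, fun l hl => by fin_cases l <;> simp_all⟩
      · exact ⟨1, h1, fun l hl => by fin_cases l <;> simp_all⟩
    · exact ⟨0, h0, fun l hl => by fin_cases l <;> simp_all⟩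
  refine ⟨m, hm, hmin, fun τ => ?_⟩
  obtain ⟨h10, h20, h21⟩ := hT τ
  have e := congrFun (h τ) m
  simp only [Matrix.vecMul, dotProduct, Fin.sum_univ_three, Pi.smul_apply, smul_eq_mul] at e
  fin_cases m
  · simp only [Fin.zero_eta] at e ⊢
    rw [h10, h20] at e
    simp only [mul_zero, add_zero] at e
    rw [mul_comm] at e
    exact ((mul_left_inj' hm).mp e).symm
  · simp only [Fin.mk_one] at e hmin ⊢
    rw [hmin 0 (by decide), h21] at e
    simp only [mul_zero, add_zero, zero_mul, zero_add] at e
    rw [mul_comm] at e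
    exact ((mul_left_inj' hm).mp e).symm
  · simp only [Fin.reduceFinMk] at e hmin ⊢
    rw [hmin 0 (by decide), hmin 1 (by decide)] at e
    simp only [zero_mul, zero_add] at e
    rw [mul_comm] at e
    exact ((mul_left_inj' hm).mp e).symm

/-- **Distinct diagonal characters do not depend on the triangularising frame.**  If `T₀(τ) M = M T₁(τ)`
for all `τ` with `M` invertible and all `T₀(τ), T₁(τ)` invertible upper triangular, then the diagonal
characters of `T₁` are a permutation of those of `T₀`; in particular pairwise distinctness transfers. -/
theorem diag_pairwise_ne_of_conj {H : Type*} (T₀ T₁ : H → Matrix (Fin 3) (Fin 3) k) (hT₀ : ∀ τ, IsUpper3 (T₀ τ))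
    (hT₁ : ∀ τ, IsUpper3 (T₁ τ)) (hdet₀ : ∀ τ, (T₀ τ).det ≠ 0) (M : Matrix (Fin 3) (Fin 3) k) (hM : M.det ≠ 0)
    (hconj : ∀ τ, T₀ τ * M = M * T₁ τ)
    (hχ : ∀ i j : Fin 3, i ≠ j → (fun τ => T₀ τ i i) ≠ fun τ => T₀ τ j j) :
    ∀ i j : Fin 3, i ≠ j → (fun τ => T₁ τ i i) ≠ fun τ => T₁ τ j j := by
  have hMu : IsUnit M.det := isUnit_iff_ne_zero.mpr hM
  -- `ψ₁ = χ_m`, `m` = top of the support of the first column of `M`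
  have hcol : (fun i => M i 0) ≠ 0 := by
    intro h0
    apply hM
    exact Matrix.det_eq_zero_of_column_eq_zero 0 fun i => congrFun h0 i
  have hev : ∀ τ, T₀ τ *ᵥ (fun i => M i 0) = T₁ τ 0 0 • fun i => M i 0 := by
    intro τ
    obtain ⟨h10, h20, -⟩ := hT₁ τ
    ext i
    have := congrFun (congrFun (hconj τ) i) 0
    simp only [Matrix.mul_apply, Fin.sum_univ_three, h10, h20, mul_zero, add_zero] at this
    simp only [Matrix.mulVec, dotProduct, Fin.sum_univ_three, Pi.smul_apply, smul_eq_mul]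
    rw [this, mul_comm]
  obtain ⟨m, hm, hmax, hψ₁⟩ := exists_eq_diag_of_common_eigenvector T₀ hT₀ _ hcol _ hev
  -- `ψ₃ = χ_{m'}`, `m'` = bottom of the support of the last row of `M⁻¹`
  have hrow : (fun j => M⁻¹ 2 j) ≠ 0 := by
    intro h0
    have hdet' : M⁻¹.det ≠ 0 := (Matrix.isUnit_nonsing_inv_det M hMu).ne_zero
    apply hdet'
    exact Matrix.det_eq_zero_of_row_eq_zero 2 fun j => congrFun h0 j
  have hconj' : ∀ τ, M⁻¹ * T₀ τ = T₁ τ * M⁻¹ := by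
    intro τ
    have := congrArg (fun X => M⁻¹ * X * M⁻¹) (hconj τ)
    rwa [Matrix.mul_assoc, Matrix.mul_nonsing_inv_cancel_right _ _ hMu, ← Matrix.mul_assoc,
      Matrix.nonsing_inv_mul _ hMu, Matrix.one_mul] at this
  have hev' : ∀ τ, Matrix.vecMul (fun j => M⁻¹ 2 j) (T₀ τ) = T₁ τ 2 2 • fun j => M⁻¹ 2 j := by
    intro τ
    obtain ⟨-, h20, h21⟩ := hT₁ τ
    ext j
    have := congrFun (congrFun (hconj' τ) 2) j
    simp only [Matrix.mul_apply, Fin.sum_univ_three, h20, h21, zero_mul, zero_add] at this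
    simp only [Matrix.vecMul, dotProduct, Fin.sum_univ_three, Pi.smul_apply, smul_eq_mul]
    rw [this]
  obtain ⟨m', hm', hmin, hψ₃⟩ := exists_eq_diag_of_common_row_eigenvector T₀ hT₀ _ hrow _ hev'
  -- `m ≠ m'`
  have hmm' : m ≠ m' := by
    intro hmm
    subst hmm
    have e : (M⁻¹ * M) 2 0 = (1 : Matrix (Fin 3) (Fin 3) k) 2 0 := by rw [Matrix.nonsing_inv_mul _ hMu]
    simp only [Matrix.mul_apply, Fin.sum_univ_three, Matrix.one_apply] at e
    simp at e
    fin_cases m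
    · simp only [Fin.zero_eta] at hm hm' hmax e
      rw [hmax 1 (by decide), hmax 2 (by decide)] at e
      simp only [mul_zero, add_zero] at e
      exact (mul_ne_zero hm' hm) e
    · simp only [Fin.mk_one] at hm hm' hmax hmin e
      rw [hmax 2 (by decide), hmin 0 (by decide)] at e
      simp only [mul_zero, add_zero, zero_mul, zero_add] at e
      exact (mul_ne_zero hm' hm) e
    · simp only [Fin.reduceFinMk] at hm hm' hmin e
      rw [hmin 0 (by decide), hmin 1 (by decide)] at e
      simp only [zero_mul, zero_add] at e
      exact (mul_ne_zero hm' hm) e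
  -- `ψ₂` from the determinant
  have hdetψ : ∀ τ, T₁ τ 0 0 * T₁ τ 1 1 * T₁ τ 2 2 = T₀ τ 0 0 * T₀ τ 1 1 * T₀ τ 2 2 := by
    intro τ
    rw [← IsUpper3.det (hT₀ τ), ← IsUpper3.det (hT₁ τ)]
    have : T₁ τ = M⁻¹ * T₀ τ * M := by
      rw [Matrix.mul_assoc, hconj τ, ← Matrix.mul_assoc, Matrix.nonsing_inv_mul _ hMu, Matrix.one_mul]
    rw [this, Matrix.det_conj' ((Matrix.isUnit_iff_isUnit_det M).mpr hMu)]
  have hne : ∀ τ (i : Fin 3), T₀ τ i i ≠ 0 := by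
    intro τ i h
    apply hdet₀ τ
    rw [IsUpper3.det (hT₀ τ)]
    fin_cases i <;> simp_all
  -- the third index
  obtain ⟨t, ht, ht', hψ₂⟩ : ∃ t : Fin 3, t ≠ m ∧ t ≠ m' ∧ ∀ τ, T₁ τ 1 1 = T₀ τ t t := by
    have key : ∀ τ, T₀ τ m m * T₁ τ 1 1 * T₀ τ m' m' = T₀ τ 0 0 * T₀ τ 1 1 * T₀ τ 2 2 := fun τ => by
      rw [← hψ₁ τ, ← hψ₃ τ, hdetψ τ]
    fin_cases m <;> fin_cases m' <;> simp at hmm'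
    · refine ⟨2, by decide, by decide, fun τ => ?_⟩
      have e := key τ
      have h0 := hne τ 0; have h1 := hne τ 1
      simp only [Fin.zero_eta, Fin.mk_one] at e
      field_simp at e
      linear_combination (exp := 1) e
    · refine ⟨1, by decide, by decide, fun τ => ?_⟩
      have e := key τ
      have h0 := hne τ 0; have h2 := hne τ 2
      simp only [Fin.zero_eta, Fin.reduceFinMk] at e
      field_simp at e
      linear_combination (exp := 1) e
    · refine ⟨2, by decide, by decide, fun τ => ?_⟩
      have e := key τ
      have h0 := hne τ 0; have h1 := hne τ 1
      simp only [Fin.zero_eta, Fin.mk_one] at e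
      field_simp at e
      linear_combination (exp := 1) e
    · refine ⟨0, by decide, by decide, fun τ => ?_⟩
      have e := key τ
      have h1 := hne τ 1; have h2 := hne τ 2
      simp only [Fin.mk_one, Fin.reduceFinMk] at e
      field_simp at e
      linear_combination (exp := 1) e
    · refine ⟨1, by decide, by decide, fun τ => ?_⟩
      have e := key τ
      have h0 := hne τ 0; have h2 := hne τ 2
      simp only [Fin.zero_eta, Fin.reduceFinMk] at e
      field_simp at e
      linear_combination (exp := 1) e
    · refine ⟨0, by decide, by decide, fun τ => ?_⟩
      have e := key τ
      have h1 := hne τ 1; have h2 := hne τ 2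
      simp only [Fin.mk_one, Fin.reduceFinMk] at e
      field_simp at e
      linear_combination (exp := 1) e
  -- conclusion
  have hσ : ∀ i : Fin 3, (fun τ => T₁ τ i i) = fun τ => T₀ τ ((![m, t, m'] : Fin 3 → Fin 3) i) ((![m, t, m'] : Fin 3 → Fin 3) i) := by
    intro i
    fin_cases i
    · exact funext hψ₁
    · exact funext hψ₂
    · exact funext hψ₃
  have hinj : Function.Injective ((![m, t, m'] : Fin 3 → Fin 3)) := by
    intro i j h
    fin_cases i <;> fin_cases j
    all_goals first
      | rfl
      | (exfalso; simp at h
         first | exact ht h.symm | exact ht h | exact hmm' h | exact hmm' h.symm | exact ht' h | exact ht' h.symm)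
  intro i j hij
  rw [hσ i, hσ j]
  exact hχ _ _ fun h => hij (hinj h)

/-! ### A separating element for three distinct sign characters -/

omit [Field k] in
/-- Signs: if `x² = y² = 1` and `x ≠ y` then `y = -x` (in a field). -/
theorem eq_neg_of_sq_eq_one [Field k] {x y : k} (hx : x * x = 1) (hy : y * y = 1) (hxy : x ≠ y) : y = -x := by
  rcases mul_self_eq_one_iff.mp hx with rfl | rfl <;> rcases mul_self_eq_one_iff.mp hy with rfl | rfl
  · exact absurd rfl hxy
  · rfl
  · exact (neg_neg (1 : k)).symm
  · exact absurd rfl hxy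

/-- **Separating element**: for three pairwise distinct multiplicative sign characters `χa, χb, χc` of `H`
(`2 ≠ 0`), some `h ∈ H` has `χa(h) ≠ χb(h) = χc(h)`. -/
theorem exists_separating {H : Type*} [Mul H] (χa χb χc : H → k) (h2 : (2 : k) ≠ 0)
    (hma : ∀ x y, χa (x * y) = χa x * χa y) (hmb : ∀ x y, χb (x * y) = χb x * χb y)
    (hmc : ∀ x y, χc (x * y) = χc x * χc y)
    (hsa : ∀ x, χa x * χa x = 1) (hsb : ∀ x, χb x * χb x = 1) (hsc : ∀ x, χc x * χc x = 1)
    (hab : χa ≠ χb) (hac : χa ≠ χc) :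
    ∃ h, χa h ≠ χb h ∧ χb h = χc h := by
  have hne : ∀ x : k, x * x = 1 → x ≠ -x := by
    intro x hx h
    have : (2 : k) * x = 0 := by linear_combination (exp := 1) h
    rcases mul_eq_zero.mp this with h' | h'
    · exact h2 h'
    · rw [h', mul_zero] at hx; exact zero_ne_one hx
  obtain ⟨h₁, hh₁⟩ := Function.ne_iff.mp hab
  by_cases hc₁ : χc h₁ = χb h₁
  · exact ⟨h₁, hh₁, hc₁.symm⟩
  obtain ⟨h₂, hh₂⟩ := Function.ne_iff.mp hac
  by_cases hb₂ : χb h₂ = χc h₂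
  · refine ⟨h₂, ?_, hb₂⟩
    rw [hb₂]; exact hh₂
  -- `h = h₁ h₂`
  have e1 : χb h₁ = -χa h₁ := eq_neg_of_sq_eq_one (hsa h₁) (hsb h₁) hh₁
  have e2 : χc h₁ = χa h₁ := by
    have := eq_neg_of_sq_eq_one (hsb h₁) (hsc h₁) (Ne.symm hc₁)
    rw [this, e1, neg_neg]
  have e3 : χc h₂ = -χa h₂ := eq_neg_of_sq_eq_one (hsa h₂) (hsc h₂) hh₂
  have e4 : χb h₂ = χa h₂ := by
    have := eq_neg_of_sq_eq_one (hsc h₂) (hsb h₂) (Ne.symm hb₂)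
    rw [this, e3, neg_neg]
  refine ⟨h₁ * h₂, ?_, ?_⟩
  · rw [hma, hmb, e1, e4, neg_mul]
    exact hne _ (by rw [mul_mul_mul_comm, hsa, hsa, mul_one])
  · rw [hmb, hmc, e1, e2, e3, e4, neg_mul, mul_neg]

end Upper

/-- **Summary (registered helper goal of `stub_point`)**: two independent eigenvectors for the same
eigenvalue force a double root of the characteristic polynomial (`3 × 3`). -/
theorem pointBorelLinAlg_sq_dvd : ∀ {F : Type} [Field F] (M : Matrix (Fin 3) (Fin 3) F) (c : F) (v w : Fin 3 → F), M *ᵥ v = c • v → M *ᵥ w = c • w → crossProduct v w ≠ 0 → (X - C c) ^ 2 ∣ M.charpoly :=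
  fun M c v w hv hw h => sq_dvd_charpoly_of_eigenvectors M c v w hv hw h

end

end Summit.Langlands.Langlands.Cruxes.MuOrdinaryFamilyRT.FreeSeedSmoothRt
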